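import Literature.NumberTheory.GaloisRepresentations.WeilDeligneOfGalois
import Literature.NumberTheory.GaloisRepresentations.WeilGroupFrobeniusPowers
import Literature.NumberTheory.GaloisRepresentations.WeilDeligneOfGaloisUnramifiedProofs
import Literature.NumberTheory.GaloisRepresentations.GaloisRep
import Literature.RepresentationTheory.Semisimple.BurnsideMatrixSpan
import Literature.LinearAlgebra.BaseChange.LinearIndependentFieldExtension
import Literature.LinearAlgebra.Matrix.NilpotentExpInjective
import Summits.Langlands.Langlands.Theorems.IrreducibilityBySelfDualityIrreducibleOffSectorWDIrreducibleBasics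
import HarnessLib

/-!
# A1-irr: an IRREDUCIBLE attached Weil–Deligne representation forces irreducibility of `ρ`
(crux stmt-Langlands-14329 `IrreducibilityBySelfDuality.IrreducibleOffSector`, supports kit
`square-integrable-place` §1; `--supports` file; STRUCTURAL: Literature imports only)

If a Weil–Deligne representation `r` attached to `ρ|_{Γ_{K_v}}` by the Grothendieck–Deligne recipe
is irreducible, then `ρ : Γ_K → GL_n(ℚ̄_ℓ)` is irreducible: `r` irreducible forces `N = 0`, so the
recipe returns `ρ|_{W_{K_v}}` itself, and a `Γ_K`-stable subspace is `r`-stable.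
Reference: Tate, Corvallis 1979, (4.1.5), (4.2.1).
-/

noncomputable section

set_option linter.dupNamespace false

open scoped MatrixGroups Matrix NumberField
open Module IsDedekindDomain
open Literature.NumberTheory.GaloisRepresentations
open Literature.NumberTheory.GaloisRepresentations.WeilGroup

namespace Summit.Langlands.Langlands.Theorems.IrreducibleOffSector.SquareIntegrablePlace


/-- **A1-irr (no semisimplicity needed).** If a Weil–Deligne representation attached to
`ρ|_{Γ_{K_v}}` by the Grothendieck–Deligne recipe is IRREDUCIBLE, then `ρ` is irreducible.
[cite: TateCorvallis1979, (4.2.1)] -/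
theorem isIrreducible_of_weilDeligne_isIrreducible {K : Type} [Field K] [NumberField K] {n ℓ : ℕ}
    [Fact ℓ.Prime]
    (ρ : FramedGaloisRep K (PadicAlgCl ℓ) n) (v : HeightOneSpectrum (𝓞 K))
    (r : WeilDeligneRep (v.adicCompletion K) (PadicAlgCl ℓ) (Fin n → PadicAlgCl ℓ))
    (hr : IsWeilDeligneOfLadic (ρ.toLocal v).toWeilGroupHom r) (hirr : r.IsIrreducible) :
    ρ.toGaloisRep.IsIrreducible := by
  have hN : r.N = 0 := N_eq_zero_of_isIrreducible hirr
  haveI : Nontrivial (Fin n → PadicAlgCl ℓ) := hirr.1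
  change (FramedRep.toRepresentation ρ).IsIrreducible
  have hb : (⊥ : Subrepresentation (FramedRep.toRepresentation ρ)).toSubmodule = ⊥ := rfl
  have ht : (⊤ : Subrepresentation (FramedRep.toRepresentation ρ)).toSubmodule = ⊤ := rfl
  haveI : Nontrivial (Subrepresentation (FramedRep.toRepresentation ρ)) := ⟨⟨⊥, ⊤, fun e => by
    have e' := congrArg Subrepresentation.toSubmodule e
    rw [hb, ht] at e'
    exact bot_ne_top e'⟩⟩
  refine ⟨fun W => ?_⟩
  -- a `Γ_K`-stable subspace is stable under `r.ρ(w) = ρ(w)` for every `w ∈ W_{K_v}`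
  have hstab : ∀ w, W.toSubmodule ≤ W.toSubmodule.comap (r.ρ w) := by
    intro w x hx
    rw [Submodule.mem_comap, ρ_apply_eq_mulVec_of_N_eq_zero hr hN w x]
    have hmem := W.apply_mem_toSubmodule
      (absGaloisRestrict K (v.adicCompletion K) (WeilGroup.toAbsGalois (v.adicCompletion K) w)) hx
    simpa [FramedRep.toWeilGroupHom_apply, FramedGaloisRep.toLocal_apply] using hmem
  rcases eq_bot_or_eq_top_of_isIrreducible hirr W.toSubmodule hstab with h' | h'
  · exact Or.inl (Subrepresentation.toSubmodule_injective (by rw [h', hb]))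
  · exact Or.inr (Subrepresentation.toSubmodule_injective (by rw [h', ht]))

end Summit.Langlands.Langlands.Theorems.IrreducibleOffSector.SquareIntegrablePlace

end
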